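import Summits.Ventures.Crystal3D.Theorems.StickyWulffConstantCoaxialWallLawEndRowDefs
import Summits.Ventures.Crystal3D.Theorems.StickyWulffConstantCoaxialWallLawForeignTilt
import Summits.Ventures.Crystal3D.Theorems.StickyWulffConstantCoaxialWallLawSkewRoots
import HarnessLib

/-!
# An integer model of the typed census row, I: sites `v/√18`, the tilted cubic frame `L`, degrees / pooled deficiency / fullness

HONEST FRAMING. Venture `Summits/Ventures/Crystal3D` (cell `crystal3d-full`), helper `--supports` the crux `CoaxialWallLaw`
(stmt-Ventures-19481, `route-Ventures-StickyWulffConstant`, REGISTERED line `WallLedgerF`, open stub `stub_coaxialTwoSlabAdhesion`).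
PLUMBING for evaluating the census objects of `…CoaxialWallLawEndRowDefs` (`IsFull`, `pooledDef`, degrees, `HasTwoPayers`) on
configurations carried by INTEGER site sets, used by the kernel floor `…CoaxialWallLawEndRowTransFloor` (seat 19481-p1 gen 12):

* §1 `ipt v = v/√18` (cubic frame; nearest neighbours of `Λ₀` at `|Δv|² = 18`): `dist = 1 ↔ dz = 18`, `dist ≤ 1 ↔ dz ≤ 18`,
  `1 ≤ dist ↔ 18 ≤ dz`, injectivity;
* §2 the frame `L = Cc.trans Qr`: `Cc` = the orthonormal cubic coordinates of `…GenericWallFloorCubicCoords` as a linear isometry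
  (`Cc (slotSite k) = ipt (slot3 k)`, `slot3 k = 3·slotInt k`), `Qr` = the reflection across `(3/5, 0, 4/5)^⊥` (rational, so that
  every basal slot gets the non-zero rise `3(−24 s₀ − 7 s₂)/(25√18)`, `L_slotSite_two`); physical points `P v = Qr (ipt v)`,
  `P u + L (slotSite k) = P (u + slot3 k)`;
* §3 `Xof S = P '' S` for `S ⊆ ℤ³`: `1`-separation from `18 ≤ dz`, degrees `= degS`, `pooledDef = pooledS`, `IsFull ↔ fullS = true`,
  payers have two payers.
WHAT THIS IS NOT: no statement about any census constant (that is the floor file); rung credit none; F-C1 not moved.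
-/

noncomputable section

namespace Summit.Ventures.Crystal3D.Theorems

open Summit.Ventures.Crystal3D Finset NearIdentity
open Literature.MathematicalPhysics.StatisticalMechanics (barlowPos fccStacking constHagg)
open scoped InnerProductSpace

namespace EndRowFloor

/-! ### §1 Integer model: the cubic frame scaled by `1/√18` -/

/-- The point with ambient coordinates `v/√18` (`v` an integer vector; nearest neighbours of `Λ₀` are at `|Δv|² = 18`). -/
def ipt (v : Fin 3 → ℤ) : EuclideanSpace ℝ (Fin 3) :=
  (Real.sqrt 18)⁻¹ • (WithLp.toLp 2 fun i => (v i : ℝ))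

/-- Integer dot product. -/
def dz (u v : Fin 3 → ℤ) : ℤ := u 0 * v 0 + u 1 * v 1 + u 2 * v 2

/-- `√18 > 0`. -/
theorem sqrt18_pos : (0 : ℝ) < Real.sqrt 18 := Real.sqrt_pos.2 (by norm_num)

/-- Coordinates of `ipt v`. -/
theorem ipt_apply (v : Fin 3 → ℤ) (i : Fin 3) : ipt v i = (Real.sqrt 18)⁻¹ * (v i : ℝ) := by
  simp [ipt]

/-- `ipt` is additive. -/
theorem ipt_add (u v : Fin 3 → ℤ) : ipt (u + v) = ipt u + ipt v := by
  ext i; simp [ipt_apply, mul_add]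

/-- `ipt` respects subtraction. -/
theorem ipt_sub (u v : Fin 3 → ℤ) : ipt (u - v) = ipt u - ipt v := by
  ext i; simp [ipt_apply, mul_sub]

/-- `ipt` respects integer scaling. -/
theorem ipt_zsmul (n : ℤ) (v : Fin 3 → ℤ) : ipt (n • v) = (n : ℝ) • ipt v := by
  ext i; simp [ipt_apply]; ring

/-- Inner products in the integer model: `⟪ipt u, ipt v⟫ = (u·v)/18`. -/
theorem inner_ipt (u v : Fin 3 → ℤ) : ⟪ipt u, ipt v⟫_ℝ = (dz u v : ℝ) / 18 := by
  have h18 : Real.sqrt 18 * Real.sqrt 18 = 18 := Real.mul_self_sqrt (by norm_num)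
  have h0 : (Real.sqrt 18)⁻¹ * (Real.sqrt 18)⁻¹ = 1 / 18 := by
    rw [← mul_inv, h18]; norm_num
  have hin : ⟪(WithLp.toLp 2 fun i => (u i : ℝ) : EuclideanSpace ℝ (Fin 3)),
      (WithLp.toLp 2 fun i => (v i : ℝ))⟫_ℝ = (dz u v : ℝ) := by
    simp [PiLp.inner_apply, Fin.sum_univ_three, dz]; ring
  rw [ipt, ipt, real_inner_smul_left, real_inner_smul_right, hin, ← mul_assoc, h0]
  ring

/-- `‖ipt w‖² = |w|²/18`. -/
theorem norm_ipt_sq (w : Fin 3 → ℤ) : ‖ipt w‖ ^ 2 = (dz w w : ℝ) / 18 := by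
  rw [← real_inner_self_eq_norm_sq, inner_ipt]

/-- Squared distances in the integer model. -/
theorem dist_ipt_sq (u v : Fin 3 → ℤ) : dist (ipt u) (ipt v) ^ 2 = (dz (u - v) (u - v) : ℝ) / 18 := by
  rw [dist_eq_norm, ← ipt_sub, norm_ipt_sq]

/-- Contact (`dist = 1`) iff `|Δ|² = 18`. -/
theorem dist_ipt_eq_one_iff (u v : Fin 3 → ℤ) : dist (ipt u) (ipt v) = 1 ↔ dz (u - v) (u - v) = 18 := by
  constructor
  · intro h
    have := dist_ipt_sq u v
    rw [h, one_pow] at this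
    have h' : (dz (u - v) (u - v) : ℝ) = 18 := by linarith
    exact_mod_cast h'
  · intro h
    have h2 : dist (ipt u) (ipt v) ^ 2 = 1 := by rw [dist_ipt_sq, h]; norm_num
    nlinarith [dist_nonneg (x := ipt u) (y := ipt v)]

/-- `dist ≤ 1` iff `|Δ|² ≤ 18`. -/
theorem dist_ipt_le_one_iff (u v : Fin 3 → ℤ) : dist (ipt u) (ipt v) ≤ 1 ↔ dz (u - v) (u - v) ≤ 18 := by
  have hd := dist_nonneg (x := ipt u) (y := ipt v)
  constructor
  · intro h
    have h2 : dist (ipt u) (ipt v) ^ 2 ≤ 1 := by nlinarith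
    rw [dist_ipt_sq] at h2
    have : (dz (u - v) (u - v) : ℝ) ≤ 18 := by linarith
    exact_mod_cast this
  · intro h
    have h' : (dz (u - v) (u - v) : ℝ) ≤ 18 := by exact_mod_cast h
    have h2 : dist (ipt u) (ipt v) ^ 2 ≤ 1 := by rw [dist_ipt_sq]; linarith
    nlinarith

/-- `1 ≤ dist` iff `18 ≤ |Δ|²`. -/
theorem one_le_dist_ipt_iff (u v : Fin 3 → ℤ) : 1 ≤ dist (ipt u) (ipt v) ↔ 18 ≤ dz (u - v) (u - v) := by
  have hd := dist_nonneg (x := ipt u) (y := ipt v)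
  constructor
  · intro h
    have h2 : 1 ≤ dist (ipt u) (ipt v) ^ 2 := by nlinarith
    rw [dist_ipt_sq] at h2
    have : (18 : ℝ) ≤ dz (u - v) (u - v) := by linarith
    exact_mod_cast this
  · intro h
    have h' : (18 : ℝ) ≤ (dz (u - v) (u - v) : ℝ) := by exact_mod_cast h
    have h2 : 1 ≤ dist (ipt u) (ipt v) ^ 2 := by rw [dist_ipt_sq]; linarith
    nlinarith

/-- `ipt` is injective. -/
theorem ipt_injective : Function.Injective ipt := by
  intro u v h
  have h0 : dist (ipt u) (ipt v) ^ 2 = 0 := by rw [h, dist_self]; ring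
  rw [dist_ipt_sq] at h0
  have hz : dz (u - v) (u - v) = 0 := by exact_mod_cast (by linarith : (dz (u - v) (u - v) : ℝ) = 0)
  have h3 : (u - v) 0 * (u - v) 0 + (u - v) 1 * (u - v) 1 + (u - v) 2 * (u - v) 2 = 0 := hz
  have n0 := mul_self_nonneg ((u - v) 0)
  have n1 := mul_self_nonneg ((u - v) 1)
  have n2 := mul_self_nonneg ((u - v) 2)
  have e0 : (u - v) 0 = 0 := mul_self_eq_zero.1 (by linarith)
  have e1 : (u - v) 1 = 0 := mul_self_eq_zero.1 (by linarith)
  have e2 : (u - v) 2 = 0 := mul_self_eq_zero.1 (by linarith)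
  funext i
  fin_cases i
  · simpa [sub_eq_zero] using e0
  · simpa [sub_eq_zero] using e1
  · simpa [sub_eq_zero] using e2

/-! ### §2 The cubic frame as a linear isometry and the tilting reflection -/

/-- The cubic frame is orthonormal. -/
theorem orthonormal_cubicFrame : Orthonormal ℝ cubicFrame := by
  rw [orthonormal_iff_ite]
  intro i j
  rw [inner_cubicFrame, cubicCoords_cubicFrame, Pi.single_apply]
  split_ifs with h1 h2 h2 <;> simp_all [eq_comm]

/-- The cubic orthonormal basis `(c₀, c₁, c₂)`. -/
def cubicOB : OrthonormalBasis (Fin 3) ℝ (EuclideanSpace ℝ (Fin 3)) :=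
  (basisOfOrthonormalOfCardEqFinrank orthonormal_cubicFrame (by simp)).toOrthonormalBasis
    (by rw [coe_basisOfOrthonormalOfCardEqFinrank]; exact orthonormal_cubicFrame)

/-- The cubic orthonormal basis is the cubic frame. -/
theorem cubicOB_apply (j : Fin 3) : cubicOB j = cubicFrame j := by
  change ((basisOfOrthonormalOfCardEqFinrank orthonormal_cubicFrame _).toOrthonormalBasis _ : Fin 3 → _) j = _
  rw [Module.Basis.coe_toOrthonormalBasis, coe_basisOfOrthonormalOfCardEqFinrank]

/-- The linear isometry `x ↦ (cubic coordinates of x)`. -/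
def Cc : EuclideanSpace ℝ (Fin 3) ≃ₗᵢ[ℝ] EuclideanSpace ℝ (Fin 3) := cubicOB.repr

/-- `Cc x` lists the cubic coordinates of `x`. -/
theorem Cc_apply (x : EuclideanSpace ℝ (Fin 3)) (i : Fin 3) : Cc x i = cubicCoords x i := by
  rw [Cc, OrthonormalBasis.repr_apply_apply, cubicOB_apply, real_inner_comm, inner_cubicFrame]

/-- The tilting unit normal `(3/5, 0, 4/5)`. -/
def nQ : EuclideanSpace ℝ (Fin 3) := WithLp.toLp 2 ![3 / 5, 0, 4 / 5]

/-- Coordinates of the tilting normal. -/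
theorem nQ_apply : nQ 0 = 3 / 5 ∧ nQ 1 = 0 ∧ nQ 2 = 4 / 5 := by
  refine ⟨?_, ?_, ?_⟩ <;> simp [nQ]

/-- Inner product with the tilting normal. -/
theorem inner_nQ (x : EuclideanSpace ℝ (Fin 3)) : ⟪x, nQ⟫_ℝ = 3 / 5 * x 0 + 4 / 5 * x 2 := by
  simp [nQ, PiLp.inner_apply, Fin.sum_univ_three]

/-- The tilting normal is a unit vector. -/
theorem norm_nQ : ‖nQ‖ = 1 := by
  have h : ‖nQ‖ ^ 2 = 1 := by
    rw [← real_inner_self_eq_norm_sq, inner_nQ]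
    simp [nQ]; norm_num
  have hn := norm_nonneg nQ
  nlinarith

/-- The tilt: reflection across `nQ^⊥`. -/
def Qr : EuclideanSpace ℝ (Fin 3) ≃ₗᵢ[ℝ] EuclideanSpace ℝ (Fin 3) := (ℝ ∙ nQ)ᗮ.reflection

/-- The tilt is the reflection `x ↦ x − 2⟪x, nQ⟫ nQ`. -/
theorem Qr_apply (x : EuclideanSpace ℝ (Fin 3)) : Qr x = x - (2 * ⟪x, nQ⟫_ℝ) • nQ :=
  reflection_unit_apply norm_nQ x

/-- THE FRAME `L` = cubic coordinates followed by the tilt. -/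
def L : EuclideanSpace ℝ (Fin 3) ≃ₗᵢ[ℝ] EuclideanSpace ℝ (Fin 3) := Cc.trans Qr

/-- Unfolding the frame `L`. -/
theorem L_apply (x : EuclideanSpace ℝ (Fin 3)) : L x = Qr (Cc x) := rfl

/-- The physical point of the model integer vector `v`. -/
def P (v : Fin 3 → ℤ) : EuclideanSpace ℝ (Fin 3) := Qr (ipt v)

/-- `P` is injective. -/
theorem P_injective : Function.Injective P := fun _ _ h => ipt_injective (Qr.injective h)

/-- `P` preserves model distances. -/
theorem dist_P (u v : Fin 3 → ℤ) : dist (P u) (P v) = dist (ipt u) (ipt v) := by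
  rw [P, P, Qr.dist_map]

/-- `P` is additive up to the tilt. -/
theorem P_add (u v : Fin 3 → ℤ) : P (u + v) = P u + Qr (ipt v) := by
  rw [P, ipt_add, map_add]; rfl

/-- The slot `k` in the integer model: `3 · slotInt k`. -/
def slot3 (k : Fin 12) : Fin 3 → ℤ := fun j => 3 * slotInt k j

/-- Coordinates of `slot3`. -/
@[simp] theorem slot3_apply (k : Fin 12) (j : Fin 3) : slot3 k j = 3 * slotInt k j := rfl

/-- Cubic coordinates of the slots: `Cc (slotSite k) = ipt (slot3 k)`. -/
theorem Cc_slotSite (k : Fin 12) : Cc (slotSite k) = ipt (slot3 k) := by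
  have h18 : Real.sqrt 18 = 3 * Real.sqrt 2 := by
    rw [show (18 : ℝ) = 3 ^ 2 * 2 by norm_num, Real.sqrt_mul (by norm_num), Real.sqrt_sq (by norm_num)]
  have hs2 : Real.sqrt 2 ≠ 0 := by positivity
  ext i
  rw [Cc_apply, cubicCoords_slotSite, ipt_apply, h18, slot3_apply]
  simp only [slotVec]
  push_cast
  field_simp

/-- `L (slotSite k) = Qr (ipt (slot3 k))`. -/
theorem L_slotSite (k : Fin 12) : L (slotSite k) = Qr (ipt (slot3 k)) := by
  rw [L_apply, Cc_slotSite]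

/-- Adding a slot image to a physical point. -/
theorem P_add_slot (u : Fin 3 → ℤ) (k : Fin 12) : P u + L (slotSite k) = P (u + slot3 k) := by
  rw [L_slotSite, ← P_add]


/-- The rise of a slot image: `(L (slotSite i))₂ = 3 (−24 sᵢ₀ − 7 sᵢ₂) / (25 √18)`. -/
theorem L_slotSite_two (i : Fin 12) :
    (L (slotSite i)) 2 = 3 / (25 * Real.sqrt 18) * ((-24 * slotInt i 0 - 7 * slotInt i 2 : ℤ) : ℝ) := by
  rw [L_slotSite, Qr_apply, inner_nQ]
  simp only [PiLp.sub_apply, PiLp.smul_apply, smul_eq_mul, ipt_apply, nQ_apply.2.2, slot3_apply]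
  push_cast
  field_simp
  ring

/-- Model slots are in-plane (model third coordinate `0`) iff their `k`-index vanishes; the six basal ones. -/
theorem slotSite_two (i : Fin 12) : (slotSite i) 2 = ((slotKIJ i).1 : ℝ) * Real.sqrt (2 / 3) := by
  rw [slotSite, Literature.MathematicalPhysics.StatisticalMechanics.barlowPos_apply_two]

/-! ### §3 Configurations carried by integer site sets -/

/-- The embedding of model integer vectors as physical points. -/
def Pemb : (Fin 3 → ℤ) ↪ EuclideanSpace ℝ (Fin 3) := ⟨P, P_injective⟩

/-- Unfolding the embedding. -/
@[simp] theorem Pemb_apply (u : Fin 3 → ℤ) : Pemb u = P u := rfl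

/-- The configuration carried by the site set `S`. -/
def Xof (S : Finset (Fin 3 → ℤ)) : Finset (EuclideanSpace ℝ (Fin 3)) := S.map Pemb

/-- Membership in the carried configuration is membership of the site. -/
theorem mem_Xof {S : Finset (Fin 3 → ℤ)} {u : Fin 3 → ℤ} : P u ∈ Xof S ↔ u ∈ S := by
  rw [Xof, Finset.mem_map]
  constructor
  · rintro ⟨v, hv, h⟩
    rw [Pemb_apply] at h
    rwa [← P_injective h]
  · intro h
    exact ⟨u, h, rfl⟩

/-- Contacts of carried points. -/
theorem dist_P_eq_one_iff (u v : Fin 3 → ℤ) : dist (P u) (P v) = 1 ↔ dz (u - v) (u - v) = 18 := by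
  rw [dist_P, dist_ipt_eq_one_iff]

/-- Closed unit balls of carried points. -/
theorem dist_P_le_one_iff (u v : Fin 3 → ℤ) : dist (P u) (P v) ≤ 1 ↔ dz (u - v) (u - v) ≤ 18 := by
  rw [dist_P, dist_ipt_le_one_iff]

/-- The carried configuration is `1`-separated iff the site set is (`|Δ|² ≥ 18`). -/
theorem sep_Xof {S : Finset (Fin 3 → ℤ)} (h : ∀ u ∈ S, ∀ v ∈ S, u ≠ v → 18 ≤ dz (u - v) (u - v)) :
    ∀ p ∈ Xof S, ∀ q ∈ Xof S, p ≠ q → 1 ≤ dist p q := by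
  intro p hp q hq hpq
  rw [Xof, Finset.mem_map] at hp hq
  obtain ⟨u, hu, rfl⟩ := hp
  obtain ⟨v, hv, rfl⟩ := hq
  have huv : u ≠ v := fun e => hpq (by rw [e])
  rw [Pemb_apply, Pemb_apply, dist_P, one_le_dist_ipt_iff]
  exact h u hu v hv huv

/-- Integer degree. -/
def degS (S : Finset (Fin 3 → ℤ)) (u : Fin 3 → ℤ) : ℕ := (S.filter fun v => dz (u - v) (u - v) = 18).card

/-- The contact shell of a carried point is carried by the integer contact shell. -/
theorem filter_contacts (S : Finset (Fin 3 → ℤ)) (u : Fin 3 → ℤ) :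
    ((Xof S).filter fun q => dist (P u) q = 1) = (S.filter fun v => dz (u - v) (u - v) = 18).map Pemb := by
  rw [Xof, Finset.filter_map]
  congr 1
  apply Finset.filter_congr
  intro v _
  simp [Function.comp, dist_P_eq_one_iff]

/-- Degrees are integer degrees. -/
theorem card_contacts (S : Finset (Fin 3 → ℤ)) (u : Fin 3 → ℤ) :
    ((Xof S).filter fun q => dist (P u) q = 1).card = degS S u := by
  rw [filter_contacts, Finset.card_map, degS]

/-- Integer pooled deficiency. -/
def pooledS (S : Finset (Fin 3 → ℤ)) (u : Fin 3 → ℤ) : ℕ :=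
  ∑ v ∈ S.filter (fun v => dz (u - v) (u - v) ≤ 18 ∧ degS S v ≤ 11), (12 - degS S v)

/-- Pooled deficiencies are integer pooled deficiencies. -/
theorem pooledDef_eq (S : Finset (Fin 3 → ℤ)) (u : Fin 3 → ℤ) : pooledDef (Xof S) (P u) = (pooledS S u : ℝ) := by
  unfold pooledDef pooledS
  have hf : ((Xof S).filter fun z => dist (P u) z ≤ 1 ∧ ((Xof S).filter fun q => dist z q = 1).card ≤ 11) =
      (S.filter fun v => dz (u - v) (u - v) ≤ 18 ∧ degS S v ≤ 11).map Pemb := by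
    rw [Xof, Finset.filter_map]
    congr 1
    apply Finset.filter_congr
    intro v _
    simp only [Function.comp, Pemb_apply, dist_P_le_one_iff]
    rw [← Xof, card_contacts]
  rw [hf, Finset.sum_map, Nat.cast_sum]
  apply Finset.sum_congr rfl
  intro v hv
  rw [Finset.mem_filter] at hv
  rw [Pemb_apply, card_contacts, Nat.cast_sub (by linarith [hv.2.2]), Nat.cast_ofNat]

/-- Integer fullness test: all twelve slot neighbours are sites. -/
def fullS (S : Finset (Fin 3 → ℤ)) (u : Fin 3 → ℤ) : Bool := decide (∀ k : Fin 12, u + slot3 k ∈ S)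

/-- `IsFull` in the frame `L` is the integer fullness test. -/
theorem isFull_iff (S : Finset (Fin 3 → ℤ)) (u : Fin 3 → ℤ) : IsFull (Xof S) L (P u) ↔ fullS S u = true := by
  unfold IsFull fullS
  rw [decide_eq_true_iff, fccSlots_eq_image]
  simp only [Finset.mem_image, Finset.mem_univ, true_and, forall_exists_index, forall_apply_eq_imp_iff]
  refine forall_congr' fun k => ?_
  rw [P_add_slot, mem_Xof]

/-- Payer ⇒ two payers. -/
theorem hasTwoPayers_of_deg {S : Finset (Fin 3 → ℤ)} {u : Fin 3 → ℤ} (h : degS S u ≤ 11) :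
    HasTwoPayers (Xof S) (P u) :=
  Or.inl (by rw [card_contacts]; exact h)


end EndRowFloor

end Summit.Ventures.Crystal3D.Theorems

end
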